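import Summits.BirchSwinnertonDyer.BirchSwinnertonDyer.Theorems.ErratumRoadFiveNonSurjCornerKolyJSwapInputs
import Summits.BirchSwinnertonDyer.BirchSwinnertonDyer.Theorems.KolyvaginRoadThreeTowerFormPrintFree
import Literature.NumberTheory.EllipticCurves.HeegnerHypothesisKroneckerProofs
import HarnessLib

/-!
# Route `ErratumRoadFive` (rung K2), crux child `NonSurjCornerKolyJ` (item stmt-BirchSwinnertonDyer-19947), registered stub
# `stub_kolyJ_max`: two swap inputs of the reading of record DISCHARGED — Gross's disjointness prime and the data at
# admissible conductors (cell `bsd-stepL`, seat `bsd-stepL-corner-p1` g9; `--supports stmt-BirchSwinnertonDyer-19947`)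

WHAT. `nonSurjCornerKolyJ_max_of_swapInputs_of_perLevel` (p520201) reads the stub ⟸ {hswapIn (i)–(iv), hlev}, where per corner
frame (i) is a prime `q ∣ d_K`, `q ∤ N_E`, `q ≠ p` and (iii) is the existence of Kolyvagin–Heegner data at every square-free
conductor over Kolyvagin primes. Both are THEOREMS on corner frames:
* (i) `exists_prime_dvd_discr_of_heegner`: `|d_K| > 4` has a prime factor `q`; a prime dividing `d_K` ramifies, so it cannot
  split — it divides neither the level (Heegner hypothesis for `N`) nor equals `p` (Heegner hypothesis for `p`); tree
  `SatisfiesHeegnerHypothesis.not_dvd_discr`.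
* (iii) koly's `nonempty_kolyvaginHeegnerData_printFree` (Gross 1991 §3 CM points of every conductor prime to `N`, print-free in
  the tree): a Kolyvagin prime is inert (`(ℓ)` prime in `𝓞_K` is a conjunct of `Zhang2014.IsKolyvaginPrime`).
**`nonSurjCornerKolyJ_max_of_levelOneSupply_of_perLevel`**: stub VERBATIM ⟸ {(ii) `−1 ∈ ρ̄_{E,7}(Γ_ℚ)` AT `p = 7` ONLY, (iv) the
level-`p` swap supply per family, hlev}; and the (T4″)@3 twin **`cornerUpper3_jetchevMax_of_levelOneSupply_of_perLevel`** ⟸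
{(iv) at level `3`, hlev}. HONEST FRAMING: three theorems, no definition ∕ fact ∕ sorry; CONDITIONAL displays; no stub closes;
nothing about any curve; T7.
References: [GrossLMS1991] §3 (Heegner points of conductor n), §4; [McCallumLMS1991] §5 Prop. 5.2; [BurungaleEtAl2026] Prop. 2.2.1;
[Jetchev2008] Thm. 1.4.
-/

set_option autoImplicit false

noncomputable section

open scoped Classical NumberField

namespace Summit.BirchSwinnertonDyer.Rank1Residual.X11b.Three.Koly

open WeierstrassCurve IsDedekindDomain NumberField Literature.NumberTheory.EllipticCurves
  Literature.NumberTheory.EllipticCurves.ModularForms Literature.NumberTheory.EllipticCurves.Jetchev2008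
  Literature.NumberTheory.EllipticCurves.Rank1Residual
  Literature.NumberTheory.GaloisRepresentations
  Literature.NumberTheory.GaloisRepresentations.DiscreteGaloisModule
  Summit.BirchSwinnertonDyer.Rank1Residual Summit.BirchSwinnertonDyer.Rank1Residual.X11b
  Summit.BirchSwinnertonDyer.Rank1Residual.JET
  Summit.BirchSwinnertonDyer.BirchSwinnertonDyer.Theorems

/-- **Gross's disjointness prime exists on every Heegner frame with `|d_K| > 4`**: for a quadratic `K` satisfying the
Heegner hypothesis for `N` and for `p`, some prime `q ∣ d_K` has `q ∤ N` and `q ≠ p` — any prime factor of `|d_K| > 1`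
(a prime dividing `d_K` does not split: `SatisfiesHeegnerHypothesis.not_dvd_discr`). This is the input «a prime
`q ∣ d_K` prime to `N_E p`» of the corner Čebotarev (`…KolyJWalkCebotarev`, `…KolyJSwapRowCornerPrime`), used there to
make `ℚ(E[p^k])` and `K` linearly disjoint. [cite: GrossLMS1991, §4 (proof of Prop. 4.1: q ∣ D ramified in K, unramified in ℚ(E_p))] -/
theorem exists_prime_dvd_discr_of_heegner {K : Type*} [Field K] [NumberField K]
    (h2 : Module.finrank ℚ K = 2) (hd : 4 < (NumberField.discr K).natAbs) {N p : ℕ}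
    (hHN : SatisfiesHeegnerHypothesis N K) (hHp : SatisfiesHeegnerHypothesis p K) :
    ∃ q : ℕ, q.Prime ∧ (q : ℤ) ∣ NumberField.discr K ∧ ¬ q ∣ N ∧ q ≠ p := by
  have hD1 : (NumberField.discr K).natAbs ≠ 1 := by omega
  have hq : ((NumberField.discr K).natAbs.minFac : ℤ) ∣ NumberField.discr K :=
    Int.natCast_dvd.mpr (Nat.minFac_dvd _)
  refine ⟨(NumberField.discr K).natAbs.minFac, Nat.minFac_prime hD1, hq, fun hqN ↦ ?_, fun hqp ↦ ?_⟩
  · exact Literature.SatisfiesHeegnerHypothesis.not_dvd_discr h2 hHN (Nat.minFac_prime hD1) hqN hq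
  · exact Literature.SatisfiesHeegnerHypothesis.not_dvd_discr h2 hHp (Nat.minFac_prime hD1) (hqp ▸ dvd_rfl) hq

/-- **Kolyvagin–Heegner data exist at every square-free conductor over Kolyvagin primes** (any `p`): koly's print-free
`nonempty_kolyvaginHeegnerData_printFree` (Gross 1991 §3), a Kolyvagin prime being inert in `K`. The input (iii) `hdata` of
`hswap_of_swapSupply` ∕ `nonSurjCornerKolyJ_max_of_swapInputs_of_perLevel`, DISCHARGED. [cite: GrossLMS1991, §3 (pp. 238–239)] -/
theorem nonempty_kolyvaginHeegnerData_of_isKolyvaginPrime {K : Type} [Field K] [NumberField K] {N : ℕ} [NeZero N]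
    {W : WeierstrassCurve ℚ} [W.IsElliptic] [W.IsGloballyMinimal] (hK : IsImaginaryQuadratic K)
    (hH : SatisfiesHeegnerHypothesis N K)
    (Dt : ModularParametrizationData W N) (β : ℤ) (ι : K →+* ℂ) (hβ : (4 * N : ℤ) ∣ β ^ 2 - NumberField.discr K)
    (p : ℕ) (m : ℕ) (hm : Squarefree m) (hq : ∀ q ∈ m.primeFactors, Zhang2014.IsKolyvaginPrime N W K p q) :
    Nonempty (KolyvaginHeegnerData Dt β ι m) :=
  nonempty_kolyvaginHeegnerData_printFree hK hH Dt β ι hβ hm fun q hq' ↦ (hq q hq').2.2.2.2.1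

/-- **`stub_kolyJ_max` ⟸ {(ii) `−1 ∈ ρ̄_{E,7}(Γ_ℚ)` at `p = 7`, (iv) the level-`p` swap supply per family, hlev}** — the
reading `nonSurjCornerKolyJ_max_of_swapInputs_of_perLevel` with its inputs (i) (disjointness prime) and (iii) (data at
admissible conductors) DISCHARGED by `exists_prime_dvd_discr_of_heegner` and `nonempty_kolyvaginHeegnerData_of_isKolyvaginPrime`.
The remaining per-family supply (iv) is VERBATIM that of p520201: `τ ≠ 1`, a transverse structure `𝒯` at level `p`, signs
`eb`, the duality count `hPT`, the local Tate pairing package (`pair`, `hperf`, `hrec`) and level-`p` classes `κ̄` with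
`hκSel` ∕ `h44c` ∕ `hκ0`. CONDITIONAL; nothing booked. [cite: McCallumLMS1991, §5 Prop. 5.2 (p. 304)]
[cite: BurungaleEtAl2026, Prop. 2.2.1 (§2.2)] [cite: Jetchev2008, Thm. 1.4 (p. 812)] -/
theorem nonSurjCornerKolyJ_max_of_levelOneSupply_of_perLevel
    (hsupplyIn : ∀ (W : WeierstrassCurve ℚ) [W.IsElliptic] [W.IsGloballyMinimal] [NeZero (W.conductorNorm ℤ)]
      (p : ℕ) [Fact p.Prime] (K : Type) [Field K] [NumberField K]
      (Dt : ModularParametrizationData W (W.conductorNorm ℤ)) (β : ℤ) (ι : K →+* ℂ),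
      p ∣ W.tamagawaProduct →
      ClassX11b W p → ¬ Surj W p → (p = 5 ∨ p = 7) → p ∣ padicValInt p W.minimalDiscriminantInt →
      ¬ Ram W p → IsImaginaryQuadratic K → 4 < (NumberField.discr K).natAbs →
      SatisfiesHeegnerHypothesis (W.conductorNorm ℤ) K → SatisfiesHeegnerHypothesis p K →
      (4 * (W.conductorNorm ℤ : ℤ)) ∣ β ^ 2 - NumberField.discr K → ¬ (p : ℤ) ∣ Dt.c →
      (p = 7 → ∃ γ : Field.absoluteGaloisGroup ℚ, ∀ P : geomTorsion W p, γ • P = -P) ∧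
      (∀ (M e : ℕ) (D : ∀ s : {m : ℕ // Squarefree m ∧ ∀ q ∈ m.primeFactors,
            Zhang2014.IsKolyvaginPrime (W.conductorNorm ℤ) W K p q ∧ M + 1 ≤ Zhang2014.kolyvaginIndex W p q},
          KolyvaginHeegnerData Dt β ι s.1), (∀ s, PDiv (D s) p M) →
        ∃ (τ : K ≃ₐ[ℚ] K) (_ : τ ≠ 1)
          (𝒯 : SelmerStructure ((W.baseChange K).torsionGaloisModule ((p ^ 1 : ℕ) : ℤ))) (eb : ℕ → Bool)
          (Z : Type) (_ : AddCommGroup Z)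
          (pair : ∀ v : HeightOneSpectrum (𝓞 K),
          galoisCohomology (((W.baseChange K).torsionGaloisModule ((p ^ 1 : ℕ) : ℤ)).toLocal (Sum.inr v)) 1 →+
          galoisCohomology (((W.baseChange K).torsionGaloisModule ((p ^ 1 : ℕ) : ℤ)).toLocal (Sum.inr v)) 1 →+ Z)
          (κb : {m : ℕ // Squarefree m ∧ ∀ q ∈ m.primeFactors,
            Zhang2014.IsKolyvaginPrime (W.conductorNorm ℤ) W K p q ∧ M + 1 ≤ Zhang2014.kolyvaginIndex W p q} →
          galoisCohomology ((W.baseChange K).torsionGaloisModule ((p ^ 1 : ℕ) : ℤ)) 1),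
          (∀ (m ℓ : ℕ), ℓ.Prime → ¬ ℓ ∣ m → eb (m * ℓ) = !eb m) ∧
          (∀ (s : {m : ℕ // Squarefree m ∧ ∀ q ∈ m.primeFactors,
            Zhang2014.IsKolyvaginPrime (W.conductorNorm ℤ) W K p q ∧ M + 1 ≤ Zhang2014.kolyvaginIndex W p q})
          (ℓ : ℕ), Zhang2014.IsKolyvaginPrime (W.conductorNorm ℤ) W K p ℓ →
          M + 1 ≤ Zhang2014.kolyvaginIndex W p ℓ → ¬ ℓ ∣ s.1 →
          ∀ v : HeightOneSpectrum (𝓞 K), (ℓ : 𝓞 K) ∈ v.asIdeal → ∀ b : Bool,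
          Nat.card ((signPart W K τ ((p ^ 1 : ℕ) : ℤ) (if b then 1 else -1)
              ((selmerF W ((p ^ 1 : ℕ) : ℤ) 𝒯 (placesDividing K s.1)).relaxedAt {v}).selmerGroup).map
            (galoisCohomology.localization ((W.baseChange K).torsionGaloisModule ((p ^ 1 : ℕ) : ℤ))
              (Sum.inr v) 1)) = p ^ 1) ∧
          (∀ (ℓ : ℕ), Zhang2014.IsKolyvaginPrime (W.conductorNorm ℤ) W K p ℓ →
          M + 1 ≤ Zhang2014.kolyvaginIndex W p ℓ → ∀ v : HeightOneSpectrum (𝓞 K), (ℓ : 𝓞 K) ∈ v.asIdeal →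
          ∀ (e : ℤ), (e = 1 ∨ e = -1) →
          ∀ (x y : galoisCohomology ((W.baseChange K).torsionGaloisModule ((p ^ 1 : ℕ) : ℤ)) 1),
          conjAct W τ ((p ^ 1 : ℕ) : ℤ) x = e • x → conjAct W τ ((p ^ 1 : ℕ) : ℤ) y = e • y →
          galoisCohomology.localization ((W.baseChange K).torsionGaloisModule ((p ^ 1 : ℕ) : ℤ)) (Sum.inr v) 1 x ∈
            𝒯 (Sum.inr v) →
          galoisCohomology.localization ((W.baseChange K).torsionGaloisModule ((p ^ 1 : ℕ) : ℤ)) (Sum.inr v) 1 y ∈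
            (W.baseChange K).kummerSelmerStructure ((p ^ 1 : ℕ) : ℤ) (Sum.inr v) →
          galoisCohomology.localization ((W.baseChange K).torsionGaloisModule ((p ^ 1 : ℕ) : ℤ)) (Sum.inr v) 1 x ≠ 0 →
          galoisCohomology.localization ((W.baseChange K).torsionGaloisModule ((p ^ 1 : ℕ) : ℤ)) (Sum.inr v) 1 y ≠ 0 →
          pair v (galoisCohomology.localization ((W.baseChange K).torsionGaloisModule ((p ^ 1 : ℕ) : ℤ)) (Sum.inr v) 1 x)
            (galoisCohomology.localization ((W.baseChange K).torsionGaloisModule ((p ^ 1 : ℕ) : ℤ)) (Sum.inr v) 1 y) ≠ 0) ∧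
          (∀ (s : {m : ℕ // Squarefree m ∧ ∀ q ∈ m.primeFactors,
            Zhang2014.IsKolyvaginPrime (W.conductorNorm ℤ) W K p q ∧ M + 1 ≤ Zhang2014.kolyvaginIndex W p q})
          (ℓ₀ ℓ : ℕ), Zhang2014.IsKolyvaginPrime (W.conductorNorm ℤ) W K p ℓ₀ → M + 1 ≤ Zhang2014.kolyvaginIndex W p ℓ₀ →
          Zhang2014.IsKolyvaginPrime (W.conductorNorm ℤ) W K p ℓ → M + 1 ≤ Zhang2014.kolyvaginIndex W p ℓ →
          ¬ ℓ₀ ∣ s.1 → ¬ ℓ ∣ s.1 → ℓ ≠ ℓ₀ →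
          ∀ v₀ : HeightOneSpectrum (𝓞 K), (ℓ₀ : 𝓞 K) ∈ v₀.asIdeal →
          ∀ v : HeightOneSpectrum (𝓞 K), (ℓ : 𝓞 K) ∈ v.asIdeal → ∀ (b : Bool)
          (a c : galoisCohomology ((W.baseChange K).torsionGaloisModule ((p ^ 1 : ℕ) : ℤ)) 1),
          a ∈ signPart W K τ ((p ^ 1 : ℕ) : ℤ) (if b then 1 else -1)
            ((selmerF W ((p ^ 1 : ℕ) : ℤ) 𝒯 (placesDividing K s.1)).relaxedAt {v₀}).selmerGroup →
          c ∈ signPart W K τ ((p ^ 1 : ℕ) : ℤ) (if b then 1 else -1)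
            (selmerF W ((p ^ 1 : ℕ) : ℤ) 𝒯 (placesDividing K (s.1 * ℓ₀ * ℓ))).selmerGroup →
          pair v₀ (galoisCohomology.localization ((W.baseChange K).torsionGaloisModule ((p ^ 1 : ℕ) : ℤ))
              (Sum.inr v₀) 1 c)
            (galoisCohomology.localization ((W.baseChange K).torsionGaloisModule ((p ^ 1 : ℕ) : ℤ))
              (Sum.inr v₀) 1 a) +
          pair v (galoisCohomology.localization ((W.baseChange K).torsionGaloisModule ((p ^ 1 : ℕ) : ℤ))
              (Sum.inr v) 1 c)
            (galoisCohomology.localization ((W.baseChange K).torsionGaloisModule ((p ^ 1 : ℕ) : ℤ))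
              (Sum.inr v) 1 a) = 0) ∧
          (∀ s, κb s ∈ signPart W K τ ((p ^ 1 : ℕ) : ℤ) (if eb s.1 then 1 else -1)
          (selmerF W ((p ^ 1 : ℕ) : ℤ) 𝒯 (placesDividing K s.1)).selmerGroup) ∧
          (∀ (s s' : {m : ℕ // Squarefree m ∧ ∀ q ∈ m.primeFactors,
            Zhang2014.IsKolyvaginPrime (W.conductorNorm ℤ) W K p q ∧ M + 1 ≤ Zhang2014.kolyvaginIndex W p q}) (ℓ : ℕ),
          Zhang2014.IsKolyvaginPrime (W.conductorNorm ℤ) W K p ℓ → M + 1 ≤ Zhang2014.kolyvaginIndex W p ℓ →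
          ¬ ℓ ∣ s.1 → s'.1 = s.1 * ℓ → ∀ v : HeightOneSpectrum (𝓞 K), (ℓ : 𝓞 K) ∈ v.asIdeal →
          (galoisCohomology.localization ((W.baseChange K).torsionGaloisModule ((p ^ 1 : ℕ) : ℤ)) (Sum.inr v) 1
              (κb s') = 0 ↔
            galoisCohomology.localization ((W.baseChange K).torsionGaloisModule ((p ^ 1 : ℕ) : ℤ)) (Sum.inr v) 1
              (κb s) = 0)) ∧
          (∀ s, κb s ≠ 0 ↔ ¬ PDiv (D s) p (M + 1))))
    (hlev : ∀ (W : WeierstrassCurve ℚ) [W.IsElliptic] [W.IsGloballyMinimal] [NeZero (W.conductorNorm ℤ)]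
      (p : ℕ) [Fact p.Prime] (K : Type) [Field K] [NumberField K]
      (Dt : ModularParametrizationData W (W.conductorNorm ℤ)) (β : ℤ) (ι : K →+* ℂ),
      p ∣ W.tamagawaProduct →
      ClassX11b W p → ¬ Surj W p → (p = 5 ∨ p = 7) → p ∣ padicValInt p W.minimalDiscriminantInt →
      ¬ Ram W p → IsImaginaryQuadratic K → 4 < (NumberField.discr K).natAbs →
      SatisfiesHeegnerHypothesis (W.conductorNorm ℤ) K → SatisfiesHeegnerHypothesis p K →
      (4 * (W.conductorNorm ℤ : ℤ)) ∣ β ^ 2 - NumberField.discr K → ¬ (p : ℤ) ∣ Dt.c →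
      ∀ (v : HeightOneSpectrum (𝓞 ℚ)) (k n : ℕ) (d : KolyvaginHeegnerData Dt β ι n), Squarefree n →
        (∀ ℓ ∈ n.primeFactors, Zhang2014.IsKolyvaginPrime (W.conductorNorm ℤ) W K p ℓ) →
        (if divOrd d p < Zhang2014.levelIndex W p n then divOrd d p else (⊤ : ℕ∞)) < (k : ℕ∞) →
        padicValNat p (W.tamagawaNumberAt v) ≤ k →
        (k : ℕ∞) + (if divOrd d p < Zhang2014.levelIndex W p n then divOrd d p else ⊤) ≤
          Zhang2014.levelIndex W p n →
        (padicValNat p (W.tamagawaNumberAt v) : ℕ∞) ≤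
          (if divOrd d p < Zhang2014.levelIndex W p n then divOrd d p else ⊤)) :
    ∀ (W : WeierstrassCurve ℚ) [W.IsElliptic] [W.IsGloballyMinimal] [NeZero (W.conductorNorm ℤ)]
      (p : ℕ) [Fact p.Prime] (K : Type) [Field K] [NumberField K]
      (Dt : ModularParametrizationData W (W.conductorNorm ℤ)) (β : ℤ) (ι : K →+* ℂ),
      p ∣ W.tamagawaProduct →
      ClassX11b W p → ¬ Surj W p → (p = 5 ∨ p = 7) → p ∣ padicValInt p W.minimalDiscriminantInt →
      ¬ Ram W p → IsImaginaryQuadratic K → 4 < (NumberField.discr K).natAbs →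
      SatisfiesHeegnerHypothesis (W.conductorNorm ℤ) K → SatisfiesHeegnerHypothesis p K →
      (4 * (W.conductorNorm ℤ : ℤ)) ∣ β ^ 2 - NumberField.discr K → ¬ (p : ℤ) ∣ Dt.c →
      ∀ (v : HeightOneSpectrum (𝓞 ℚ)) (s : ℕ), s ≤ padicValNat p (W.tamagawaNumberAt v) →
        ∀ (n : ℕ) (d : KolyvaginHeegnerData Dt β ι n), Squarefree n →
          (∀ ℓ ∈ n.primeFactors, Zhang2014.IsKolyvaginPrime (W.conductorNorm ℤ) W K p ℓ ∧
            s ≤ Zhang2014.kolyvaginIndex W p ℓ) → PDiv d p s := by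
  refine nonSurjCornerKolyJ_max_of_swapInputs_of_perLevel ?_ hlev
  intro W _ _ _ p _ K _ _ Dt β ι htam hX hns h57 hv hnr hK' hd hHN hHp hβ hc
  obtain ⟨hneg7, hsup⟩ := hsupplyIn W p K Dt β ι htam hX hns h57 hv hnr hK' hd hHN hHp hβ hc
  exact ⟨exists_prime_dvd_discr_of_heegner hK'.1 hd hHN hHp, hneg7,
    fun m hm hq ↦ nonempty_kolyvaginHeegnerData_of_isKolyvaginPrime hK' hHN Dt β ι hβ p m hm hq, hsup⟩

/-- **At a (T4″)@3 corner frame `|d_K| > 4`**: `K` quadratic with `d_K` odd and `3 ∤ d_K` has `|d_K| ≥ 5`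
(Hermite–Minkowski `|d_K| > 2`, so `|d_K| ∈ {3, 4}` is excluded by `3 ∤ d_K` and oddness). [folklore] -/
theorem four_lt_natAbs_discr_of_odd {K : Type*} [Field K] [NumberField K] (h2 : Module.finrank ℚ K = 2)
    (hodd : Odd (NumberField.discr K)) (h3 : ¬ (3 : ℤ) ∣ NumberField.discr K) :
    4 < (NumberField.discr K).natAbs := by
  have hgt : 2 < |NumberField.discr K| := NumberField.abs_discr_gt_two (by rw [h2]; exact one_lt_two)
  rw [← Int.natCast_natAbs] at hgt
  have hgt' : 2 < (NumberField.discr K).natAbs := by exact_mod_cast hgt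
  obtain ⟨k, hk⟩ := Int.natAbs_odd.mpr hodd
  have h3' : ¬ 3 ∣ (NumberField.discr K).natAbs := fun h ↦ h3 (by exact_mod_cast Int.natCast_dvd.mpr h)
  omega

/-- **`stub_upper3_jetchevMax` (19111 Upper kit) ⟸ {(iv) the level-`3` swap supply per family, hlev}** — the reading
`cornerUpper3_jetchevMax_of_swapInputs_of_perLevel` (p520517) with (i) and (iii) DISCHARGED: at a (T4″)@3 corner frame
(`E ∈ X11b` at `3`, so `3 ∣ N`; `K` Heegner for `N`, hence for `3`, and `3 ∤ d_K`; `d_K` odd) `|d_K| > 4`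
(`four_lt_natAbs_discr_of_odd`), so the disjointness prime exists (`exists_prime_dvd_discr_of_heegner`), and the data at
admissible conductors exist (`nonempty_kolyvaginHeegnerData_of_isKolyvaginPrime`). CONDITIONAL; nothing booked.
[cite: McCallumLMS1991, §5 Prop. 5.2 (p. 304)] [cite: BurungaleEtAl2026, Prop. 2.2.1 (§2.2)] -/
theorem cornerUpper3_jetchevMax_of_levelOneSupply_of_perLevel
    (hsupplyIn : ∀ (W : WeierstrassCurve ℚ) [W.IsElliptic] [W.IsGloballyMinimal] [NeZero (W.conductorNorm ℤ)]
      (K : Type) [Field K] [NumberField K]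
      (Dt : ModularParametrizationData W (W.conductorNorm ℤ)) (β : ℤ) (ι : K →+* ℂ),
      ClassX11b W 3 → ¬ Surj W 3 →
      IsImaginaryQuadratic K → SatisfiesHeegnerHypothesis (W.conductorNorm ℤ) K →
      Odd (NumberField.discr K) →
      (4 * (W.conductorNorm ℤ : ℤ)) ∣ β ^ 2 - NumberField.discr K → ¬ (3 : ℤ) ∣ Dt.c →
      ∀ (M e : ℕ) (D : ∀ s : {m : ℕ // Squarefree m ∧ ∀ q ∈ m.primeFactors,
            Zhang2014.IsKolyvaginPrime (W.conductorNorm ℤ) W K 3 q ∧ M + 1 ≤ Zhang2014.kolyvaginIndex W 3 q},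
          KolyvaginHeegnerData Dt β ι s.1), (∀ s, PDiv (D s) 3 M) →
        ∃ (τ : K ≃ₐ[ℚ] K) (_ : τ ≠ 1)
          (𝒯 : SelmerStructure ((W.baseChange K).torsionGaloisModule ((3 ^ 1 : ℕ) : ℤ))) (eb : ℕ → Bool)
          (Z : Type) (_ : AddCommGroup Z)
          (pair : ∀ v : HeightOneSpectrum (𝓞 K),
          galoisCohomology (((W.baseChange K).torsionGaloisModule ((3 ^ 1 : ℕ) : ℤ)).toLocal (Sum.inr v)) 1 →+
          galoisCohomology (((W.baseChange K).torsionGaloisModule ((3 ^ 1 : ℕ) : ℤ)).toLocal (Sum.inr v)) 1 →+ Z)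
          (κb : {m : ℕ // Squarefree m ∧ ∀ q ∈ m.primeFactors,
            Zhang2014.IsKolyvaginPrime (W.conductorNorm ℤ) W K 3 q ∧ M + 1 ≤ Zhang2014.kolyvaginIndex W 3 q} →
          galoisCohomology ((W.baseChange K).torsionGaloisModule ((3 ^ 1 : ℕ) : ℤ)) 1),
          (∀ (m ℓ : ℕ), ℓ.Prime → ¬ ℓ ∣ m → eb (m * ℓ) = !eb m) ∧
          (∀ (s : {m : ℕ // Squarefree m ∧ ∀ q ∈ m.primeFactors,
            Zhang2014.IsKolyvaginPrime (W.conductorNorm ℤ) W K 3 q ∧ M + 1 ≤ Zhang2014.kolyvaginIndex W 3 q})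
          (ℓ : ℕ), Zhang2014.IsKolyvaginPrime (W.conductorNorm ℤ) W K 3 ℓ →
          M + 1 ≤ Zhang2014.kolyvaginIndex W 3 ℓ → ¬ ℓ ∣ s.1 →
          ∀ v : HeightOneSpectrum (𝓞 K), (ℓ : 𝓞 K) ∈ v.asIdeal → ∀ b : Bool,
          Nat.card ((signPart W K τ ((3 ^ 1 : ℕ) : ℤ) (if b then 1 else -1)
              ((selmerF W ((3 ^ 1 : ℕ) : ℤ) 𝒯 (placesDividing K s.1)).relaxedAt {v}).selmerGroup).map
            (galoisCohomology.localization ((W.baseChange K).torsionGaloisModule ((3 ^ 1 : ℕ) : ℤ))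
              (Sum.inr v) 1)) = 3 ^ 1) ∧
          (∀ (ℓ : ℕ), Zhang2014.IsKolyvaginPrime (W.conductorNorm ℤ) W K 3 ℓ →
          M + 1 ≤ Zhang2014.kolyvaginIndex W 3 ℓ → ∀ v : HeightOneSpectrum (𝓞 K), (ℓ : 𝓞 K) ∈ v.asIdeal →
          ∀ (e : ℤ), (e = 1 ∨ e = -1) →
          ∀ (x y : galoisCohomology ((W.baseChange K).torsionGaloisModule ((3 ^ 1 : ℕ) : ℤ)) 1),
          conjAct W τ ((3 ^ 1 : ℕ) : ℤ) x = e • x → conjAct W τ ((3 ^ 1 : ℕ) : ℤ) y = e • y →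
          galoisCohomology.localization ((W.baseChange K).torsionGaloisModule ((3 ^ 1 : ℕ) : ℤ)) (Sum.inr v) 1 x ∈
            𝒯 (Sum.inr v) →
          galoisCohomology.localization ((W.baseChange K).torsionGaloisModule ((3 ^ 1 : ℕ) : ℤ)) (Sum.inr v) 1 y ∈
            (W.baseChange K).kummerSelmerStructure ((3 ^ 1 : ℕ) : ℤ) (Sum.inr v) →
          galoisCohomology.localization ((W.baseChange K).torsionGaloisModule ((3 ^ 1 : ℕ) : ℤ)) (Sum.inr v) 1 x ≠ 0 →
          galoisCohomology.localization ((W.baseChange K).torsionGaloisModule ((3 ^ 1 : ℕ) : ℤ)) (Sum.inr v) 1 y ≠ 0 →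
          pair v (galoisCohomology.localization ((W.baseChange K).torsionGaloisModule ((3 ^ 1 : ℕ) : ℤ)) (Sum.inr v) 1 x)
            (galoisCohomology.localization ((W.baseChange K).torsionGaloisModule ((3 ^ 1 : ℕ) : ℤ)) (Sum.inr v) 1 y) ≠ 0) ∧
          (∀ (s : {m : ℕ // Squarefree m ∧ ∀ q ∈ m.primeFactors,
            Zhang2014.IsKolyvaginPrime (W.conductorNorm ℤ) W K 3 q ∧ M + 1 ≤ Zhang2014.kolyvaginIndex W 3 q})
          (ℓ₀ ℓ : ℕ), Zhang2014.IsKolyvaginPrime (W.conductorNorm ℤ) W K 3 ℓ₀ → M + 1 ≤ Zhang2014.kolyvaginIndex W 3 ℓ₀ →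
          Zhang2014.IsKolyvaginPrime (W.conductorNorm ℤ) W K 3 ℓ → M + 1 ≤ Zhang2014.kolyvaginIndex W 3 ℓ →
          ¬ ℓ₀ ∣ s.1 → ¬ ℓ ∣ s.1 → ℓ ≠ ℓ₀ →
          ∀ v₀ : HeightOneSpectrum (𝓞 K), (ℓ₀ : 𝓞 K) ∈ v₀.asIdeal →
          ∀ v : HeightOneSpectrum (𝓞 K), (ℓ : 𝓞 K) ∈ v.asIdeal → ∀ (b : Bool)
          (a c : galoisCohomology ((W.baseChange K).torsionGaloisModule ((3 ^ 1 : ℕ) : ℤ)) 1),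
          a ∈ signPart W K τ ((3 ^ 1 : ℕ) : ℤ) (if b then 1 else -1)
            ((selmerF W ((3 ^ 1 : ℕ) : ℤ) 𝒯 (placesDividing K s.1)).relaxedAt {v₀}).selmerGroup →
          c ∈ signPart W K τ ((3 ^ 1 : ℕ) : ℤ) (if b then 1 else -1)
            (selmerF W ((3 ^ 1 : ℕ) : ℤ) 𝒯 (placesDividing K (s.1 * ℓ₀ * ℓ))).selmerGroup →
          pair v₀ (galoisCohomology.localization ((W.baseChange K).torsionGaloisModule ((3 ^ 1 : ℕ) : ℤ))
              (Sum.inr v₀) 1 c)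
            (galoisCohomology.localization ((W.baseChange K).torsionGaloisModule ((3 ^ 1 : ℕ) : ℤ))
              (Sum.inr v₀) 1 a) +
          pair v (galoisCohomology.localization ((W.baseChange K).torsionGaloisModule ((3 ^ 1 : ℕ) : ℤ))
              (Sum.inr v) 1 c)
            (galoisCohomology.localization ((W.baseChange K).torsionGaloisModule ((3 ^ 1 : ℕ) : ℤ))
              (Sum.inr v) 1 a) = 0) ∧
          (∀ s, κb s ∈ signPart W K τ ((3 ^ 1 : ℕ) : ℤ) (if eb s.1 then 1 else -1)
          (selmerF W ((3 ^ 1 : ℕ) : ℤ) 𝒯 (placesDividing K s.1)).selmerGroup) ∧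
          (∀ (s s' : {m : ℕ // Squarefree m ∧ ∀ q ∈ m.primeFactors,
            Zhang2014.IsKolyvaginPrime (W.conductorNorm ℤ) W K 3 q ∧ M + 1 ≤ Zhang2014.kolyvaginIndex W 3 q}) (ℓ : ℕ),
          Zhang2014.IsKolyvaginPrime (W.conductorNorm ℤ) W K 3 ℓ → M + 1 ≤ Zhang2014.kolyvaginIndex W 3 ℓ →
          ¬ ℓ ∣ s.1 → s'.1 = s.1 * ℓ → ∀ v : HeightOneSpectrum (𝓞 K), (ℓ : 𝓞 K) ∈ v.asIdeal →
          (galoisCohomology.localization ((W.baseChange K).torsionGaloisModule ((3 ^ 1 : ℕ) : ℤ)) (Sum.inr v) 1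
              (κb s') = 0 ↔
            galoisCohomology.localization ((W.baseChange K).torsionGaloisModule ((3 ^ 1 : ℕ) : ℤ)) (Sum.inr v) 1
              (κb s) = 0)) ∧
          (∀ s, κb s ≠ 0 ↔ ¬ PDiv (D s) 3 (M + 1)))
    (hlev : ∀ (W : WeierstrassCurve ℚ) [W.IsElliptic] [W.IsGloballyMinimal] [NeZero (W.conductorNorm ℤ)]
      (K : Type) [Field K] [NumberField K]
      (Dt : ModularParametrizationData W (W.conductorNorm ℤ)) (β : ℤ) (ι : K →+* ℂ),
      ClassX11b W 3 → ¬ Surj W 3 →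
      IsImaginaryQuadratic K → SatisfiesHeegnerHypothesis (W.conductorNorm ℤ) K →
      Odd (NumberField.discr K) →
      (4 * (W.conductorNorm ℤ : ℤ)) ∣ β ^ 2 - NumberField.discr K → ¬ (3 : ℤ) ∣ Dt.c →
      ∀ (v : HeightOneSpectrum (𝓞 ℚ)) (k n : ℕ) (d : KolyvaginHeegnerData Dt β ι n), Squarefree n →
        (∀ ℓ ∈ n.primeFactors, Zhang2014.IsKolyvaginPrime (W.conductorNorm ℤ) W K 3 ℓ) →
        (if divOrd d 3 < Zhang2014.levelIndex W 3 n then divOrd d 3 else (⊤ : ℕ∞)) < (k : ℕ∞) →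
        padicValNat 3 (W.tamagawaNumberAt v) ≤ k →
        (k : ℕ∞) + (if divOrd d 3 < Zhang2014.levelIndex W 3 n then divOrd d 3 else ⊤) ≤
          Zhang2014.levelIndex W 3 n →
        (padicValNat 3 (W.tamagawaNumberAt v) : ℕ∞) ≤
          (if divOrd d 3 < Zhang2014.levelIndex W 3 n then divOrd d 3 else ⊤)) :
    ∀ (W : WeierstrassCurve ℚ) [W.IsElliptic] [W.IsGloballyMinimal] [NeZero (W.conductorNorm ℤ)]
      (K : Type) [Field K] [NumberField K]
      (Dt : ModularParametrizationData W (W.conductorNorm ℤ)) (β : ℤ) (ι : K →+* ℂ),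
      ClassX11b W 3 → ¬ Surj W 3 →
      IsImaginaryQuadratic K → SatisfiesHeegnerHypothesis (W.conductorNorm ℤ) K →
      Odd (NumberField.discr K) →
      (4 * (W.conductorNorm ℤ : ℤ)) ∣ β ^ 2 - NumberField.discr K → ¬ (3 : ℤ) ∣ Dt.c →
      ∀ (v : HeightOneSpectrum (𝓞 ℚ)) (s : ℕ), s ≤ padicValNat 3 (W.tamagawaNumberAt v) →
        ∀ (n : ℕ) (d : KolyvaginHeegnerData Dt β ι n), Squarefree n →
          (∀ ℓ ∈ n.primeFactors, Zhang2014.IsKolyvaginPrime (W.conductorNorm ℤ) W K 3 ℓ ∧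
            s ≤ Zhang2014.kolyvaginIndex W 3 ℓ) → PDiv d 3 s := by
  haveI : Fact (Nat.Prime 3) := ⟨Nat.prime_three⟩
  refine cornerUpper3_jetchevMax_of_swapInputs_of_perLevel ?_ hlev
  intro W _ _ _ K _ _ Dt β ι hX hns hK' hHN hodd hβ hc
  have h3N : 3 ∣ W.conductorNorm ℤ := dvd_conductorNorm_of_mult hX.2.2.1
  have hH3 : SatisfiesHeegnerHypothesis 3 K := hHN.of_dvd h3N
  have h3d : ¬ (3 : ℤ) ∣ NumberField.discr K := by
    exact_mod_cast Literature.SatisfiesHeegnerHypothesis.not_dvd_discr hK'.1 hHN Nat.prime_three h3N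
  have hd : 4 < (NumberField.discr K).natAbs := four_lt_natAbs_discr_of_odd hK'.1 hodd h3d
  exact ⟨exists_prime_dvd_discr_of_heegner hK'.1 hd hHN hH3,
    fun m hm hq ↦ nonempty_kolyvaginHeegnerData_of_isKolyvaginPrime hK' hHN Dt β ι hβ 3 m hm hq,
    hsupplyIn W K Dt β ι hX hns hK' hHN hodd hβ hc⟩

end Summit.BirchSwinnertonDyer.Rank1Residual.X11b.Three.Koly

end
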